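/-
Copyright: cell pub-balaban-gaps (YM BLITZ Y1, track G1), seat g1-p2 GEN 7 (unit `pub-balaban-gaps-g1-p2`).  Row (D4) NODE O,
JUNCTION J-3′ continued: the FIBRED flat propagator `G′ ⊗ 1_F` (print's `G′(1)` acts on 𝔤-valued functions COMPONENTWISE by the
scalar `G′`; the perturbation `V′(A)` of (3.52) acts in the fibre by `ad_{A′(b)}` — so the carrier on which Bałaban's `V′(A)` can be
typed is the fibred one).  Block letters are blind to a diagonal fibre: 57's k-uniform value ∕ derivative letters and Cor. 3.5's
step at `U = 1` lift verbatim to `G′ ⊗ 1_F` for EVERY finite fibre `F`.  HONEST FRAMING: the flat operator is the tree's scalar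
model tensored with the identity; `V` is a hypothesis SHAPE (Bałaban's `V′(A)` NOT constructed); (D4) instance 0∕1; NOT BetaPertH,
NOT continuum, NOT Clay.
-/
import Summits.QuantumFields.BalabanUV.Gaps.D4WalkBlockFlatOneScale

/-!
# `Gaps.D4WalkBlockFlatFibre` — the fibred flat propagator `G′ ⊗ 1_F` in block currency: letters and Cor. 3.5's step at `U = 1`
# (cell pub-balaban-gaps, seat g1-p2 gen 7)

HONEST DEPENDENCY (cell pub-balaban, verbatim): continuum YM on T⁴ ⇐ BetaPertH ∧ nine spine estimates (0/9 proved);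
BetaPertH ⇐ (D1) ∧ (D4) ∧ CAP+tail.

[B9] (3.23) ∕ (3.50): at `U = 1` the covariant Laplace operator on 𝔤-valued `λ` is the scalar `−Δ^η` on each component
(`R(1) = id`), and (3.52)'s `V′₁(A)` couples components through `i[A′(b), ·] = i·ad_{A′(b)}` — a FIBREWISE (site-local) coefficient
times a covariant difference.  THIS FILE: §1 `blockNorm_blockDiagonal_le` (the block norms of `M ⊗ 1_F = blockDiagonal (fun _ => M)`
over the cube map `cub ∘ fst` are those of `M` — the fibre is summed only along the diagonal); §2 **`flatLettersFibre_oneScaleTorus`**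
(57's `flatLetters_oneScaleTorus` for `Gc ⊗ 1_F` and `(∂^η_μ ⊗ 1_F)(Gc ⊗ 1_F) = (∂^η_μG′) ⊗ 1_F`: the same `(δ₀, C)`, every finite fibre
`F`); §3 **`blockWalkExpansion_flatPerturbFibre_oneScaleTorus`** (57's END on the fibred carrier `Site P 0 × F`: for every
σ-independent entrywise-holomorphic `V(u)` with the (3.61)-shape domination letter w.r.t. `∂^η_μ ⊗ 1_F`, `(Gc ⊗ 1)(1 − V(u)(Gc ⊗ 1))⁻¹`
is a block walk expansion with derivative letters, constants uniform in `K`, the volume AND the fibre).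
WHAT IT IS NOT.  Bałaban's `V′(A)` (the (3.52)-structured object with fibre coefficients `ad_{A′(b)}`, `F′_{1,k}(i ad_{A′(b)})` and its
(3.61) letter — the next junction); (D4) instance 0∕1; words of row (D4) UNCHANGED.

References: T. Bałaban, Comm. Math. Phys. **99** (1985) 389–434 [B9], (3.23) p. 394, (3.50)–(3.52) p. 400, (3.61)–(3.64) p. 402,
Cor. 3.5 p. 407; Comm. Math. Phys. **96** (1984) 223–250 [4], Prop. 2.2 (2.67) p. 234.
-/

noncomputable section

namespace Summit.QuantumFields.BalabanUV.Gaps.D4WalkBlockFlatFibre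

open Metric Set Finset
open scoped Matrix
open Literature.MathematicalPhysics.QuantumFieldTheory.Balaban1983to89
open Literature.MathematicalPhysics.QuantumFieldTheory.Balaban1983to89.B9SectDWalk (DomBy)
open Literature.MathematicalPhysics.QuantumFieldTheory.Balaban1983to89.B9Thm34Ext (toB6)
open Literature.MathematicalPhysics.QuantumFieldTheory.Balaban1983to89.B9Thm37GlueTorus (torusGeom tdist1 tdist1_nonneg)
open Literature.MathematicalPhysics.QuantumFieldTheory.Balaban1983to89.TreeLengthTorus (TPt)
open Literature.MathematicalPhysics.QuantumFieldTheory.Balaban1983to89.B5TorusCover (UT)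
open Literature.MathematicalPhysics.QuantumFieldTheory.Balaban1983to89.B11SectG (RowSum)
open Literature.MathematicalPhysics.QuantumFieldTheory.Balaban1983to89.B5Ineq137Torus (Nv)
open Literature.MathematicalPhysics.QuantumFieldTheory.Balaban1983to89.B6Prop22OneScaleTorus (Index)
open Literature.MathematicalPhysics.QuantumFieldTheory.Balaban1983to89.B1RG242Torus (tower deriv)
open Summit.QuantumFields.BalabanUV.Gaps.D4WalkBlock
  (rowMass blockNorm blockNorm_nonneg rowMass_le_blockNorm blockNorm_le_of_rowMass_le BlockWalkExpansion)
open Summit.QuantumFields.BalabanUV.Gaps.D4WalkBlockDerivative (blockWalkExpansion_perturb_of_derivLetters)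
open Summit.QuantumFields.BalabanUV.Gaps.D4WalkBlockFlatLetters
  (cubeOf flatLetters_oneScaleTorus blockWalkExpansion_const map_ofReal_mul)

/-! ## §1. Block norms are blind to a diagonal fibre -/

section Fibre

variable {ν : ℕ} {K : Fin ν → ℕ} {p F : Type} [Fintype p] [Fintype F] [DecidableEq F]
variable (cub : p → UT K)

/-- Row masses of `M ⊗ 1_F` over the cube map `cub ∘ fst`: the fibre contributes only its diagonal entry. -/
theorem rowMass_blockDiagonal (M : Matrix p p ℂ) (i : p) (a : F) (Y' : UT K) :
    rowMass (fun q : p × F => cub q.1) (Matrix.blockDiagonal fun _ : F => M) (i, a) Y' = rowMass cub M i Y' := by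
  classical
  unfold rowMass
  rw [← Finset.sum_filter_add_sum_filter_not (Finset.univ.filter fun q : p × F => cub q.1 = Y') (fun q => q.2 = a)]
  have h0 : ∑ q ∈ (Finset.univ.filter fun q : p × F => cub q.1 = Y').filter (fun q => ¬q.2 = a),
      ‖Matrix.blockDiagonal (fun _ : F => M) (i, a) q‖ = 0 := by
    refine Finset.sum_eq_zero fun q hq => ?_
    have hq' : q.2 ≠ a := (Finset.mem_filter.1 hq).2
    rw [show q = (q.1, q.2) from rfl, Matrix.blockDiagonal_apply, if_neg (Ne.symm hq'), norm_zero]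
  rw [h0, add_zero]
  -- the diagonal part is a copy of the row of `M`
  refine Finset.sum_nbij' (fun q => q.1) (fun j => (j, a)) ?_ ?_ ?_ ?_ ?_
  · intro q hq
    simp only [Finset.mem_filter, Finset.mem_univ, true_and] at hq ⊢
    exact hq.1
  · intro j hj
    simp only [Finset.mem_filter, Finset.mem_univ, true_and] at hj
    simpa using hj
  · intro q hq
    simp only [Finset.mem_filter, Finset.mem_univ, true_and] at hq
    exact Prod.ext rfl hq.2.symm
  · intro j _; rfl
  · intro q hq
    simp only [Finset.mem_filter, Finset.mem_univ, true_and] at hq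
    rw [show q = (q.1, q.2) from rfl, Matrix.blockDiagonal_apply, if_pos hq.2.symm]

/-- **`‖M ⊗ 1_F‖_{Y,Y′} ≤ ‖M‖_{Y,Y′}`** for the cube map `cub ∘ fst` (in fact equality for a non-empty fibre). -/
theorem blockNorm_blockDiagonal_le (M : Matrix p p ℂ) (Y Y' : UT K) :
    blockNorm (fun q : p × F => cub q.1) (fun q : p × F => cub q.1) (Matrix.blockDiagonal fun _ : F => M) Y Y' ≤
      blockNorm cub cub M Y Y' :=
  blockNorm_le_of_rowMass_le _ _ _ Y Y' (blockNorm_nonneg cub cub M Y Y') fun q hq => by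
    obtain ⟨i, a⟩ := q
    rw [rowMass_blockDiagonal]
    have h := rowMass_le_blockNorm cub cub M i Y'
    rw [show cub i = Y from hq] at h
    exact h

/-- `(M ⊗ 1_F)(N ⊗ 1_F) = (MN) ⊗ 1_F`. -/
theorem blockDiagonal_const_mul [DecidableEq p] (M N : Matrix p p ℂ) :
    Matrix.blockDiagonal (fun _ : F => M) * Matrix.blockDiagonal (fun _ : F => N) =
      Matrix.blockDiagonal (fun _ : F => M * N) := by
  rw [← Matrix.blockDiagonal_mul]

end Fibre

/-! ## §2. The fibred flat letters on the one-scale torus family -/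

section Letters

/-- **57's FLAT LETTERS FOR `G′ ⊗ 1_F`, EVERY FINITE FIBRE `F`**: the same `(δ₀, C)` (functions of `d, L, a, m²`): for every member,
every fibre and all cubes, `‖Gc ⊗ 1_F‖_{Y,Y′} ≤ C·e^{−½δ₀d₁}` and `‖(∂c_μ ⊗ 1_F)(Gc ⊗ 1_F)‖_{Y,Y′} ≤ C·e^{−½δ₀d₁}` — the fibred flat
propagator `G′(1)` of [B9] ((3.23) at `U = 1`: componentwise) carries 55's value and derivative letters, uniformly in `K`, volume, fibre.
[cite: Balaban1985BackgroundPropagators, (3.23) p.394, (3.50) p.400, Thm 3.1 (3.42) p.397; Balaban1984PropagatorsII, Prop. 2.2 (2.67) p.234] -/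
theorem flatLettersFibre_oneScaleTorus (d L : ℕ) (hd : 1 ≤ d) (hL : Odd L ∧ 1 < L) {a : ℝ} (ha : 0 < a) {msq : ℝ}
    (hmsq : 0 ≤ msq) :
    ∃ δ₀ C : ℝ, 0 < δ₀ ∧ 0 < C ∧ ∀ (i : Index d L) (F : Type) [Fintype F] [DecidableEq F], ∀ Y Y' : UT (Nv i.P i.P.K),
      blockNorm (fun q : Site i.P 0 × F => cubeOf i.P q.1) (fun q : Site i.P 0 × F => cubeOf i.P q.1)
          (Matrix.blockDiagonal fun _ : F => ((tower i.P a msq).G i.P.K).map ((↑) : ℝ → ℂ)) Y Y' ≤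
          C * Real.exp (-(δ₀ / 2 * tdist1 (Nv i.P i.P.K) Y Y')) ∧
        ∀ μ : Fin i.P.d,
          blockNorm (fun q : Site i.P 0 × F => cubeOf i.P q.1) (fun q : Site i.P 0 × F => cubeOf i.P q.1)
              (Matrix.blockDiagonal (fun _ : F => (deriv i.P 0 i.P.eps μ).map ((↑) : ℝ → ℂ)) *
                Matrix.blockDiagonal (fun _ : F => ((tower i.P a msq).G i.P.K).map ((↑) : ℝ → ℂ))) Y Y' ≤
            C * Real.exp (-(δ₀ / 2 * tdist1 (Nv i.P i.P.K) Y Y')) := by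
  obtain ⟨δ₀, C, hδ₀, hC, h⟩ := flatLetters_oneScaleTorus d L hd hL ha hmsq
  refine ⟨δ₀, C, hδ₀, hC, fun i F _ _ Y Y' => ⟨?_, fun μ => ?_⟩⟩
  · exact (blockNorm_blockDiagonal_le (cubeOf i.P) _ Y Y').trans (h i Y Y').1
  · rw [blockDiagonal_const_mul, ← map_ofReal_mul]
    exact (blockNorm_blockDiagonal_le (cubeOf i.P) _ Y Y').trans ((h i Y Y').2 μ)

end Letters

/-! ## §3. Cor. 3.5's step at `U = 1` on the fibred flat propagator -/

section Step

variable {d L : ℕ} {a msq : ℝ}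
variable {dd N' : ℕ} {E : Type*} [NormedAddCommGroup E] [NormedSpace ℂ E]

/-- **[B9] COR. 3.5's STEP AT `U = 1` ON THE FIBRED FLAT PROPAGATOR `G′ ⊗ 1_F` — UNIFORM IN `K`, THE VOLUME AND THE FIBRE.**  As 57's
`blockWalkExpansion_flatPerturb_oneScaleTorus`, on the carrier `Site P 0 × F` with cube map `cubeOf ∘ fst`, the flat kernel
`Gc ⊗ 1_F` and the differences `∂c_μ ⊗ 1_F`: for every σ-independent entrywise-holomorphic `V(u)` with the (3.61)-shape domination
letter `‖V(u)S‖_{Y,Y′} ≤ α₀‖S‖ + Σ_μ α_μ‖(∂c_μ ⊗ 1)S‖` (the shape of (3.52)'s `V′₁(A)`: fibrewise `ad`-coefficients × differences), cube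
row sum `(μ, c_μ)`, `0 ≤ μ`, `2μ ≤ ε`, `2μ ≤ ½δ₀ − ε − μ`, margin `c_μ(c_μ·1·(1·((α₀ + Σα_μ·1)C))c_μ)c_μ < 1`:
`(Gc ⊗ 1)(1 − V(u)(Gc ⊗ 1))⁻¹` is a block walk expansion at `(ε − 2μ, ½δ₀ − ε − 3μ, c_μC(1·(1−q)⁻¹)c_μ, ½δ₀ − 2μ)` with relative
derivative letters `1` and dominating distances. [cite: Balaban1985BackgroundPropagators, Cor. 3.5 p.407, (3.50)–(3.52) p.400, (3.60)–(3.65) pp.402–403, Thm 3.1 (3.42) p.397; Balaban1984PropagatorsII, Prop. 2.2 (2.67) p.234; Balaban1988RG2Cluster, (1.11) p.5] -/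
theorem blockWalkExpansion_flatPerturbFibre_oneScaleTorus (hd : 1 ≤ d) (hL : Odd L ∧ 1 < L) (ha : 0 < a) (hmsq : 0 ≤ msq) :
    ∃ δ₀ C : ℝ, 0 < δ₀ ∧ 0 < C ∧ ∀ (i : Index d L) (F : Type) [Fintype F] [DecidableEq F] (c₀ : B13.Consts)
      (X : Finset (UT (Nv i.P i.P.K))) (R : ℝ)
      (V : E → Matrix (Site i.P 0 × F) (Site i.P 0 × F) ℂ) (α₀ : ℝ) (α : Fin i.P.d → ℝ) (ε μ cμ : ℝ),
      (∀ j k, DifferentiableOn ℂ (fun u => V u j k) (ball (0 : E) R)) → 0 ≤ α₀ → (∀ ν, 0 ≤ α ν) →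
      (∀ u ∈ ball (0 : E) R, ∀ (S : Matrix (Site i.P 0 × F) (Site i.P 0 × F) ℂ) (Y Y' : UT (Nv i.P i.P.K)),
        blockNorm (fun q : Site i.P 0 × F => cubeOf i.P q.1) (fun q : Site i.P 0 × F => cubeOf i.P q.1) (V u * S) Y Y' ≤
          α₀ * blockNorm (fun q : Site i.P 0 × F => cubeOf i.P q.1) (fun q : Site i.P 0 × F => cubeOf i.P q.1) S Y Y' +
            ∑ ν, α ν * blockNorm (fun q : Site i.P 0 × F => cubeOf i.P q.1) (fun q : Site i.P 0 × F => cubeOf i.P q.1)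
              (Matrix.blockDiagonal (fun _ : F => (deriv i.P 0 i.P.eps ν).map ((↑) : ℝ → ℂ)) * S) Y Y') →
      0 ≤ μ → 2 * μ ≤ ε → 2 * μ ≤ δ₀ / 2 - ε - μ → 0 ≤ cμ →
      RowSum (toB6 (torusGeom (Nv i.P i.P.K) 0 0 0) 0 True) μ cμ →
      cμ * (cμ * 1 * (1 * ((α₀ + ∑ ν, α ν * 1) * C)) * cμ) * cμ < 1 →
      ∃ (W : Type) (T : W → (TPt dd N' → ℂ) → E → Matrix (Site i.P 0 × F) (Site i.P 0 × F) ℂ) (SX' : Set W) (A' : W → ℝ)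
        (D' : W → UT (Nv i.P i.P.K) → UT (Nv i.P i.P.K) → ℝ),
        BlockWalkExpansion c₀ (fun q : Site i.P 0 × F => cubeOf i.P q.1) (fun q : Site i.P 0 × F => cubeOf i.P q.1)
          (fun (_ : TPt dd N' → ℂ) u =>
            Matrix.blockDiagonal (fun _ : F => ((tower i.P a msq).G i.P.K).map ((↑) : ℝ → ℂ)) *
              (1 - V u * Matrix.blockDiagonal (fun _ : F => ((tower i.P a msq).G i.P.K).map ((↑) : ℝ → ℂ)))⁻¹) X R
          (ε - 2 * μ) (δ₀ / 2 - ε - μ - 2 * μ)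
          (cμ * C * (1 * (1 - cμ * (cμ * 1 * (1 * ((α₀ + ∑ ν, α ν * 1) * C)) * cμ) * cμ)⁻¹) * cμ)
          T SX' A' D' (δ₀ / 2 - 2 * μ) ∧
        (∀ (ν : Fin i.P.d) ω (σ : TPt dd N' → ℂ), (∀ j, ‖σ j‖ ≤ Real.exp c₀.κ₁) → ∀ u ∈ ball (0 : E) R, ∀ Y Y',
          blockNorm (fun q : Site i.P 0 × F => cubeOf i.P q.1) (fun q : Site i.P 0 × F => cubeOf i.P q.1)
              (Matrix.blockDiagonal (fun _ : F => (deriv i.P 0 i.P.eps ν).map ((↑) : ℝ → ℂ)) * T ω σ u) Y Y' ≤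
            1 * (A' ω * Real.exp (-((δ₀ / 2 - 2 * μ) * D' ω Y Y')))) ∧
        ∀ ω, DomBy (toB6 (torusGeom (Nv i.P i.P.K) 0 0 0) 0 True) (D' ω) := by
  obtain ⟨δ₀, C, hδ₀, hC, hflat⟩ := flatLettersFibre_oneScaleTorus d L hd hL ha hmsq
  refine ⟨δ₀, C, hδ₀, hC, fun i F _ _ c₀ X R V α₀ α ε μ cμ hVan hα₀ hα hV hμ hμε hμκ hcμ hrow hq => ?_⟩
  have hW := blockWalkExpansion_const (dd := dd) (N' := N') (E := E) c₀ (fun q : Site i.P 0 × F => cubeOf i.P q.1) X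
    (Matrix.blockDiagonal (fun _ : F => ((tower i.P a msq).G i.P.K).map ((↑) : ℝ → ℂ))) R (ε := ε) (κ := δ₀ / 2 - ε - μ)
    (ρ := δ₀ / 2) hC.le (by linarith) (fun Y Y' => (hflat i F Y Y').1)
  have hD : ∀ (ν : Fin i.P.d) (ω : Unit) (σ : TPt dd N' → ℂ), (∀ j, ‖σ j‖ ≤ Real.exp c₀.κ₁) → ∀ u ∈ ball (0 : E) R,
      ∀ Y Y' : UT (Nv i.P i.P.K),
        blockNorm (fun q : Site i.P 0 × F => cubeOf i.P q.1) (fun q : Site i.P 0 × F => cubeOf i.P q.1)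
            (Matrix.blockDiagonal (fun _ : F => (deriv i.P 0 i.P.eps ν).map ((↑) : ℝ → ℂ)) *
              Matrix.blockDiagonal (fun _ : F => ((tower i.P a msq).G i.P.K).map ((↑) : ℝ → ℂ))) Y Y' ≤
          1 * (C * Real.exp (-(δ₀ / 2 * tdist1 (Nv i.P i.P.K) Y Y'))) := by
    intro ν _ σ _ u _ Y Y'
    rw [one_mul]
    exact (hflat i F Y Y').2 ν
  exact blockWalkExpansion_perturb_of_derivLetters
    (Dop := fun ν => Matrix.blockDiagonal (fun _ : F => (deriv i.P 0 i.P.eps ν).map ((↑) : ℝ → ℂ)))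
    (B := fun _ => (1 : ℝ)) hW (fun _ Y Y' => le_rfl) (fun _ => zero_le_one) hD hVan hα₀ hα hV hμ hμε hμκ (by linarith)
    hC.le hcμ hrow hq

end Step

end Summit.QuantumFields.BalabanUV.Gaps.D4WalkBlockFlatFibre

end
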